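import Summits.BirchSwinnertonDyer.BirchSwinnertonDyer.Theorems.ManinLocalTwoThreeStevensIntegralityStevensProp14
import Summits.BirchSwinnertonDyer.BirchSwinnertonDyer.Theorems.ManinLocalTwoThreeStevensIntegralityConstKernel
import Literature.NumberTheory.EllipticCurves.ManinConstantClassCertificateTwist
import Literature.NumberTheory.EllipticCurves.ManinConstantQuadraticTwistStevensHoldsProofs
import Literature.NumberTheory.EllipticCurves.NeronIsogenyScalingHoldsProofs
import Literature.NumberTheory.EllipticCurves.ManinConstantGamma1Gamma0LedgerProofs
import HarnessLib

/-!
# The quadratic-twist class certificate for the Manin constant, with its five Stevens/Česnavičius/Néron fact binders discharged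
(route `ManinLocalTwoThree`, cruxes C2/C3; cell bsd-f2-manin, prover p2 gen 25)

The tree's certificate theorems (`Literature/NumberTheory/EllipticCurves/ManinConstantQuadraticTwistClassCertificate.lean`,
`…/ManinConstantClassCertificateTwist.lean`: `q ∤ c₀(𝒜)` for a class that is the `χ_{q*}`-twist of a class semistable at `q`;
`c₀(𝒜) = ±1` for an Edixhoven–Česnavičius–twist covered class) carry the binders
`h14 : stevens1989_exists_optimal_gamma1ParametrizationData`, `h52 : stevens1989_neronLattice_quadraticTwist_oddPrime`,
`hNS : integral_neronScaling_of_isGloballyMinimal`, `h212 : cesnavicius2018_lemma_2_12_constKernel`,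
`h65 : cesnaviciusNeururerSaha_lemma_6_5_dvd`.  All five are now THEOREMS of the tree (`h14` from modularity:
`stevens1989_exists_optimal_gamma1ParametrizationData_of_exists_isNewformOf`, this seat; `h212`:
`cesnavicius2018_lemma_2_12_constKernel_holds`, this seat; `stevens1989_neronLattice_quadraticTwist_oddPrime_holds`,
`integral_neronScaling_of_isGloballyMinimal_holds`, `cesnaviciusNeururerSaha_lemma_6_5_dvd_holds`), so the certificate is restated
with only modularity `hnf`, the semistable-primewise Manin facts `hM`/`hAU`/`hC2` (Mazur, Abbes–Ullmo, Česnavičius), and where printed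
Edixhoven's local theorems / Mazur's torsion theorem.  One-line compositions.

HONEST FRAMING: no Manin constant is computed unconditionally here (modularity and `hM`/`hAU`/`hC2` remain hypotheses, exactly the
inputs of C2/C3); C2/C3 OPEN as filed (⟸ CDT); Manin's conjecture and BSD are NOT proved.
-/

set_option autoImplicit false

set_option linter.dupNamespace false

noncomputable section

open scoped MatrixGroups ModularForm
open CongruenceSubgroup
open WeierstrassCurve Literature.NumberTheory.EllipticCurves Literature.NumberTheory.EllipticCurves.ModularForms

namespace Summit.BirchSwinnertonDyer.BirchSwinnertonDyer.Theorems.ManinLocalTwoThree.StevensIntegrality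

/-- **`q ∤ c₀(𝒜)` for a class presented as the `χ_{q*}`-twist of a class semistable at the odd prime `q`** — the tree's
`not_dvd_maninConstant_of_isTwistOfSemistableAt` with its five Stevens/Česnavičius/Néron fact binders DISCHARGED (Stevens (1.4) ⟸
modularity `hnf`; Stevens (5.2), Néron scaling, Česnavičius Lemma 2.12, ČNS Lemma 6.5 are theorems): only modularity and the three
semistable-primewise Manin facts `hM`/`hAU`/`hC2` remain. [cite: Stevens1989, Prop. (1.4), Lemmas (5.2), (5.4)]
[cite: Cesnavicius2018, Thm. 1.2 and Lemma 2.12] -/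
theorem not_dvd_maninConstant_of_isTwistOfSemistableAt'
    {W : WeierstrassCurve ℚ} [W.IsElliptic] {W' : WeierstrassCurve ℚ} [W'.IsElliptic] [W'.IsGloballyMinimal]
    (hnf : exists_isNewformOf)
    (hM : mazur_not_dvd_maninConstant_of_odd)
    (hAU : abbesUllmo_not_dvd_maninConstant_of_not_dvd_level)
    (hC2 : cesnavicius_not_two_dvd_maninConstant_of_two_dvd_level)
    {q : ℕ} [Fact q.Prime] (hq2 : q ≠ 2)
    (htw : IsIsogenous W (W'.quadraticTwist (((-1 : ℤ) ^ (q / 2) * q : ℤ) : ℚ)))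
    (hN'N : W'.conductorNorm ℤ ∣ W.conductorNorm ℤ) (hqN : q ^ 2 ∣ W.conductorNorm ℤ)
    (hNq : W'.conductorNorm ℤ * q ∣ W.conductorNorm ℤ) (hqN' : ¬ q ^ 2 ∣ W'.conductorNorm ℤ)
    (hadd : ¬ W.HasGoodReductionAtPrime q ∧ ¬ W.HasMultiplicativeReductionAtPrime q)
    (htors : ∀ (V : WeierstrassCurve ℚ) [V.IsElliptic] [V.IsGloballyMinimal],
      IsIsogenous W V → ¬ q ∣ V.torsionOrder)
    (W₀ : WeierstrassCurve ℚ) [W₀.IsElliptic] [W₀.IsGloballyMinimal] {N₀ : ℕ} [NeZero N₀]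
    (D₀ : ModularParametrizationData W₀ N₀) (hiso : IsIsogenous W W₀)
    (h₀ : ∀ z ∈ D₀.L.lattice, ∃ w ∈ periodLattice D₀.f, z = D₀.c * w) :
    ¬ (q : ℤ) ∣ D₀.maninConstant :=
  not_dvd_maninConstant_of_isTwistOfSemistableAt
    (stevens1989_exists_optimal_gamma1ParametrizationData_of_exists_isNewformOf hnf)
    stevens1989_neronLattice_quadraticTwist_oddPrime_holds integral_neronScaling_of_isGloballyMinimal_holds
    cesnavicius2018_lemma_2_12_constKernel_holds cesnaviciusNeururerSaha_lemma_6_5_dvd_holds hnf hM hAU hC2 hq2 htw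
    hN'N hqN hNq hqN' hadd htors W₀ D₀ hiso h₀

/-- The `q ≥ 11` form (torsion clause from Mazur's theorem `hMz`), five fact binders discharged.
[cite: Stevens1989, Prop. (1.4), Lemmas (5.2), (5.4)] [cite: Mazur1977, Thm. (7') p. 35] -/
theorem not_dvd_maninConstant_of_isTwistOfSemistableAt_of_eleven_le'
    {W : WeierstrassCurve ℚ} [W.IsElliptic] {W' : WeierstrassCurve ℚ} [W'.IsElliptic] [W'.IsGloballyMinimal]
    (hnf : exists_isNewformOf)
    (hM : mazur_not_dvd_maninConstant_of_odd)
    (hAU : abbesUllmo_not_dvd_maninConstant_of_not_dvd_level)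
    (hC2 : cesnavicius_not_two_dvd_maninConstant_of_two_dvd_level)
    (hMz : ∀ V : WeierstrassCurve ℚ, Mazur1977_addOrderOf_le V)
    {q : ℕ} [Fact q.Prime] (h11 : 11 ≤ q)
    (htw : IsIsogenous W (W'.quadraticTwist (((-1 : ℤ) ^ (q / 2) * q : ℤ) : ℚ)))
    (hN'N : W'.conductorNorm ℤ ∣ W.conductorNorm ℤ) (hqN : q ^ 2 ∣ W.conductorNorm ℤ)
    (hNq : W'.conductorNorm ℤ * q ∣ W.conductorNorm ℤ) (hqN' : ¬ q ^ 2 ∣ W'.conductorNorm ℤ)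
    (hadd : ¬ W.HasGoodReductionAtPrime q ∧ ¬ W.HasMultiplicativeReductionAtPrime q)
    (W₀ : WeierstrassCurve ℚ) [W₀.IsElliptic] [W₀.IsGloballyMinimal] {N₀ : ℕ} [NeZero N₀]
    (D₀ : ModularParametrizationData W₀ N₀) (hiso : IsIsogenous W W₀)
    (h₀ : ∀ z ∈ D₀.L.lattice, ∃ w ∈ periodLattice D₀.f, z = D₀.c * w) :
    ¬ (q : ℤ) ∣ D₀.maninConstant :=
  not_dvd_maninConstant_of_isTwistOfSemistableAt_of_eleven_le
    (stevens1989_exists_optimal_gamma1ParametrizationData_of_exists_isNewformOf hnf)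
    stevens1989_neronLattice_quadraticTwist_oddPrime_holds integral_neronScaling_of_isGloballyMinimal_holds
    cesnavicius2018_lemma_2_12_constKernel_holds cesnaviciusNeururerSaha_lemma_6_5_dvd_holds hnf hM hAU hC2 hMz h11
    htw hN'N hqN hNq hqN' hadd W₀ D₀ hiso h₀

/-- **The twist road at a square prime, witness form** — `not_dvd_maninConstant_of_twistSemistableWitnessAt` with its five fact binders
discharged. [cite: Stevens1989, Prop. (1.4), Lemmas (5.2), (5.4)] [cite: Cesnavicius2018, Thm. 1.2 and Lemma 2.12] -/
theorem not_dvd_maninConstant_of_twistSemistableWitnessAt'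
    (hnf : exists_isNewformOf)
    (hM : mazur_not_dvd_maninConstant_of_odd)
    (hAU : abbesUllmo_not_dvd_maninConstant_of_not_dvd_level)
    (hC2 : cesnavicius_not_two_dvd_maninConstant_of_two_dvd_level)
    (hMz : ∀ V : WeierstrassCurve ℚ, Mazur1977_addOrderOf_le V)
    (W' : WeierstrassCurve ℚ) [W'.IsElliptic] [W'.IsGloballyMinimal] {N' : ℕ} [NeZero N']
    (D' : ModularParametrizationData W' N')
    (hopt : ∀ z ∈ D'.L.lattice, ∃ w ∈ periodLattice D'.f, z = D'.c * w)
    {q : ℕ} [Fact q.Prime] (htw : TwistSemistableWitnessAt W' q) :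
    ¬ (q : ℤ) ∣ D'.maninConstant :=
  not_dvd_maninConstant_of_twistSemistableWitnessAt
    (stevens1989_exists_optimal_gamma1ParametrizationData_of_exists_isNewformOf hnf)
    stevens1989_neronLattice_quadraticTwist_oddPrime_holds integral_neronScaling_of_isGloballyMinimal_holds
    cesnavicius2018_lemma_2_12_constKernel_holds cesnaviciusNeururerSaha_lemma_6_5_dvd_holds hnf hM hAU hC2 hMz W'
    D' hopt htw

/-- **`c₀(𝒜) = ±1` for an Edixhoven–Česnavičius–twist covered class** — the tree's
`classAbsManinConstantEqOne_of_isEdixhovenCesnaviciusTwistCovered` with the five Stevens/Česnavičius/Néron fact binders discharged: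
remaining inputs are modularity, `hM`/`hAU`/`hC`, Edixhoven's two local theorems `hEA`/`hEB` and Mazur's torsion theorem `hMz`.
[cite: EdixhovenManin1991, §1 and Thm. 3] [cite: Cesnavicius2018, Thm. 1.2 and Lemma 2.12] [cite: Stevens1989, Prop. (1.4)] -/
theorem classAbsManinConstantEqOne_of_isEdixhovenCesnaviciusTwistCovered'
    (hM : mazur_not_dvd_maninConstant_of_odd)
    (hAU : abbesUllmo_not_dvd_maninConstant_of_not_dvd_level)
    (hC : cesnavicius_not_two_dvd_maninConstant_of_two_dvd_level)
    (hEA : edixhoven_not_dvd_maninConstant_of_not_potentiallyGoodOrdinary)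
    (hEB : edixhoven_not_dvd_maninConstant_of_kodairaSymbol_ne)
    (hnf : exists_isNewformOf)
    (hMz : ∀ V : WeierstrassCurve ℚ, Mazur1977_addOrderOf_le V)
    (W : WeierstrassCurve ℚ) (hcov : IsEdixhovenCesnaviciusTwistCovered W) :
    ClassAbsManinConstantEqOne W :=
  classAbsManinConstantEqOne_of_isEdixhovenCesnaviciusTwistCovered hM hAU hC hEA hEB hnf
    (stevens1989_exists_optimal_gamma1ParametrizationData_of_exists_isNewformOf hnf)
    stevens1989_neronLattice_quadraticTwist_oddPrime_holds integral_neronScaling_of_isGloballyMinimal_holds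
    cesnavicius2018_lemma_2_12_constKernel_holds cesnaviciusNeururerSaha_lemma_6_5_dvd_holds hMz W hcov

/-- Binder form of the previous theorem (`p ∤ c` for every prime and every optimal datum of every minimal member), five fact binders
discharged. [cite: EdixhovenManin1991, §1 and Thm. 3] [cite: Cesnavicius2018, Thm. 1.2] -/
theorem not_dvd_maninConstant_of_isEdixhovenCesnaviciusTwistCovered'
    (hM : mazur_not_dvd_maninConstant_of_odd)
    (hAU : abbesUllmo_not_dvd_maninConstant_of_not_dvd_level)
    (hC : cesnavicius_not_two_dvd_maninConstant_of_two_dvd_level)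
    (hEA : edixhoven_not_dvd_maninConstant_of_not_potentiallyGoodOrdinary)
    (hEB : edixhoven_not_dvd_maninConstant_of_kodairaSymbol_ne)
    (hnf : exists_isNewformOf)
    (hMz : ∀ V : WeierstrassCurve ℚ, Mazur1977_addOrderOf_le V)
    {W : WeierstrassCurve ℚ} (hcov : IsEdixhovenCesnaviciusTwistCovered W)
    (W' : WeierstrassCurve ℚ) [W'.IsElliptic] [W'.IsGloballyMinimal] {N' : ℕ} [NeZero N']
    (D' : ModularParametrizationData W' N') (hiso : IsIsogenous W W')
    (hopt : ∀ z ∈ D'.L.lattice, ∃ w ∈ periodLattice D'.f, z = D'.c * w)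
    (p : ℕ) (hp : p.Prime) : ¬ (p : ℤ) ∣ D'.maninConstant :=
  not_dvd_maninConstant_of_isEdixhovenCesnaviciusTwistCovered hM hAU hC hEA hEB hnf
    (stevens1989_exists_optimal_gamma1ParametrizationData_of_exists_isNewformOf hnf)
    stevens1989_neronLattice_quadraticTwist_oddPrime_holds integral_neronScaling_of_isGloballyMinimal_holds
    cesnavicius2018_lemma_2_12_constKernel_holds cesnaviciusNeururerSaha_lemma_6_5_dvd_holds hMz hcov W' D' hiso
    hopt p hp

end Summit.BirchSwinnertonDyer.BirchSwinnertonDyer.Theorems.ManinLocalTwoThree.StevensIntegrality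

end
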